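import Mathlib
import Summits.RiemannHypothesis.RiemannHypothesis.Theorems.IntegerScrewWalkPoincareMertens
import HarnessLib

/-!
# Route `IntegerScrew` — PROP. 24.7 (the `1/L` Poincaré inequality) INSIDE the `p`-free atom

CONTINUUM-LIMIT §25.10 (e) / §25.11 (c) price the residual of the exit-death flow on a true cell by the
Poincaré inequality of the cell itself.  The cell is the `p`-free atom `𝒜 = Nat.smoothNumbers p ∩ [1, M]`
(harmonic weights, deaths by all prime-power divisors — for a `p`-free `x` these are exactly the deaths by the
primes `< p`).  The smallest-prime path `x → x/minFac x → ⋯ → 1` of `IntegerScrewWalkPoincareMertens` stays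
inside `𝒜` (divisors of `p`-free numbers are `p`-free) and the users of an edge inside `𝒜` are a subset of
all its users, so PROP. 24.7 holds on the atom with the SAME constant:

* `walk_poincare_mertens_atom` — `Σ_{x∈𝒜}(1/x)(g x − g 1)² ≤ ⌊log₂M⌋·Σ_{y∈𝒜, y≥2} Π_{q≤minFac y}(1−1/q)⁻¹·(1/y)(g y − g(y/minFac y))²`;
* **`walk_poincare_mertens_dirichlet_atom`** — with a Mertens constant `C` (`Π_{q≤r}(1−1/q)⁻¹ ≤ C log r` for
  primes `r ≤ M`): `Σ_{x∈𝒜}(1/x)(g x − g 1)² ≤ ⌊log₂M⌋·C·D_𝒜(g)`,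
  `D_𝒜(g) = Σ_{x∈𝒜}(1/x)Σ_{n∣x}Λ(n)(g x − g(x/n))²` — the atom's internal Dirichlet form;
* `walk_poincare_mertens_dirichlet_atom_exp_five` — unconditional, `C = e⁵`.

RH-free, elementary.  Nothing in this file bears on the truth of RH.
References: CONTINUUM-LIMIT §24.7, §25.10–25.11 (rh-explicit A6-PIVOT); M. Suzuki, J. Lond. Math. Soc. (2) 108
(2023) 1448–1487 [Suzuki2023].
-/

noncomputable section

set_option linter.dupNamespace false -- D-0017: `Summit.<S>.<S>.…` is the designed namespace

namespace Summit.RiemannHypothesis.RiemannHypothesis.Theorems.IntegerScrew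

open Finset Real
open ArithmeticFunction (vonMangoldt cardFactors)
open scoped ArithmeticFunction.Omega

/-! ### Small private copies (the originals in `IntegerScrewWalkPoincareMertens` are private) -/

/-- `Ω(x) = Ω(x / minFac x) + 1` for `x ≥ 2`. -/
private theorem cardFactors_div_minFac'' {x : ℕ} (hx : 2 ≤ x) : Ω (x / x.minFac) + 1 = Ω x := by
  obtain ⟨n, rfl⟩ : ∃ n, x = n + 2 := ⟨x - 2, by omega⟩
  rw [ArithmeticFunction.cardFactors_apply, ArithmeticFunction.cardFactors_apply, Nat.primeFactorsList_add_two,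
    List.length_cons]

/-- `2^{Ω(x)} ≤ x` for `x ≥ 1`. -/
private theorem two_pow_cardFactors_le'' {x : ℕ} (hx : 1 ≤ x) : 2 ^ Ω x ≤ x := by
  induction x using Nat.strong_induction_on with
  | _ x ih =>
    rcases lt_or_ge x 2 with h | h
    · have : x = 1 := by omega
      subst this; simp
    · have hlt : x / x.minFac < x := Nat.div_lt_self (by omega) (Nat.minFac_prime (by omega)).one_lt
      have h1 : 1 ≤ x / x.minFac := Nat.div_pos (Nat.minFac_le (by omega)) (Nat.minFac_pos x)
      have := ih _ hlt h1
      rw [← cardFactors_div_minFac'' h, pow_succ]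
      calc 2 ^ Ω (x / x.minFac) * 2 ≤ (x / x.minFac) * x.minFac :=
            Nat.mul_le_mul this (Nat.minFac_prime (by omega)).two_le
        _ = x := Nat.div_mul_cancel (Nat.minFac_dvd x)

/-- `Ω(x) ≤ ⌊log₂ x⌋`. -/
private theorem cardFactors_le_log_two'' {x : ℕ} (hx : 1 ≤ x) : Ω x ≤ Nat.log 2 x :=
  Nat.le_log_of_pow_le (by norm_num) (two_pow_cardFactors_le'' hx)

/-- The smallest-prime death is part of the Dirichlet form. -/
private theorem minFac_term_le_dirichlet_term'' (g : ℕ → ℝ) {y : ℕ} (hy : 2 ≤ y) :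
    (1 / (y : ℝ)) * (Real.log y.minFac * (g y - g (y / y.minFac)) ^ 2) ≤
      (1 / (y : ℝ)) * ∑ n ∈ y.divisors, vonMangoldt n * (g y - g (y / n)) ^ 2 := by
  refine mul_le_mul_of_nonneg_left ?_ (by positivity)
  have hp : y.minFac.Prime := Nat.minFac_prime (by omega)
  have hmem : y.minFac ∈ y.divisors := Nat.mem_divisors.2 ⟨Nat.minFac_dvd y, by omega⟩
  have hΛ : vonMangoldt y.minFac = Real.log y.minFac := by
    rw [ArithmeticFunction.vonMangoldt_apply_prime hp]
  calc Real.log y.minFac * (g y - g (y / y.minFac)) ^ 2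
      = vonMangoldt y.minFac * (g y - g (y / y.minFac)) ^ 2 := by rw [hΛ]
    _ ≤ ∑ n ∈ y.divisors, vonMangoldt n * (g y - g (y / n)) ^ 2 :=
        Finset.single_le_sum (f := fun n => vonMangoldt n * (g y - g (y / n)) ^ 2)
          (fun n _ => mul_nonneg ArithmeticFunction.vonMangoldt_nonneg (sq_nonneg _)) hmem

/-! ### PROP. 24.7 on the atom -/

/-- **PROP. 24.7 on the `p`-free atom, Euler-product form.**  For every `M`, `p`, `g`:
`Σ_{x≤M, x p-free}(1/x)(g x − g 1)² ≤ ⌊log₂M⌋·Σ_{2≤y≤M, y p-free} Π_{q ≤ minFac y}(1 − 1/q)⁻¹·(1/y)(g y − g(y/minFac y))²`. -/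
theorem walk_poincare_mertens_atom (M p : ℕ) (g : ℕ → ℝ) :
    ∑ x ∈ (Icc 1 M).filter (· ∈ Nat.smoothNumbers p), (1 / (x : ℝ)) * (g x - g 1) ^ 2 ≤
      (Nat.log 2 M : ℝ) * ∑ y ∈ (Icc 2 M).filter (· ∈ Nat.smoothNumbers p),
        (∏ q ∈ (y.minFac + 1).primesBelow, (1 - 1 / (q : ℝ))⁻¹) *
          ((1 / (y : ℝ)) * (g y - g (y / y.minFac)) ^ 2) := by
  set e : ℕ → ℝ := fun y => (g y - g (y / y.minFac)) ^ 2 with he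
  set eul : ℕ → ℝ := fun y => ∏ q ∈ (y.minFac + 1).primesBelow, (1 - 1 / (q : ℝ))⁻¹ with heul
  have he0 : ∀ y, 0 ≤ e y := fun y => sq_nonneg _
  set P : ℕ → ℕ → Prop := fun x y => 2 ≤ y ∧ x / y ∈ Nat.smoothNumbers (y.minFac + 1) with hP
  set A := (Icc 1 M).filter (· ∈ Nat.smoothNumbers p) with hA
  have h1 : ∑ x ∈ A, (1 / (x : ℝ)) * (g x - g 1) ^ 2 ≤
      ∑ x ∈ A, (Nat.log 2 M : ℝ) * ((1 / (x : ℝ)) * ∑ y ∈ x.divisors with P x y, e y) := by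
    refine Finset.sum_le_sum fun x hx => ?_
    have hx' := mem_Icc.1 (mem_filter.1 hx).1
    have hΩ : (Ω x : ℝ) ≤ Nat.log 2 M := by
      exact_mod_cast (cardFactors_le_log_two'' hx'.1).trans (Nat.log_mono_right hx'.2)
    have hSnn : 0 ≤ ∑ y ∈ x.divisors with P x y, e y := Finset.sum_nonneg fun y _ => he0 y
    calc (1 / (x : ℝ)) * (g x - g 1) ^ 2 ≤ (1 / (x : ℝ)) * ((Ω x : ℝ) * ∑ y ∈ x.divisors with P x y, e y) :=
          mul_le_mul_of_nonneg_left (sq_sub_le_cardFactors_mul_sum_path g hx'.1) (by positivity)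
      _ ≤ (1 / (x : ℝ)) * ((Nat.log 2 M : ℝ) * ∑ y ∈ x.divisors with P x y, e y) :=
          mul_le_mul_of_nonneg_left (mul_le_mul_of_nonneg_right hΩ hSnn) (by positivity)
      _ = _ := by ring
  -- exchange the sums: the path points y of a p-free x are p-free
  have hcomm : ∑ x ∈ A, ((1 / (x : ℝ)) * ∑ y ∈ x.divisors with P x y, e y) =
      ∑ y ∈ (Icc 2 M).filter (· ∈ Nat.smoothNumbers p), e y *
        ∑ x ∈ A.filter (fun x => y ∣ x ∧ x / y ∈ Nat.smoothNumbers (y.minFac + 1)), (1 / (x : ℝ)) := by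
    simp_rw [Finset.mul_sum]
    refine (Finset.sum_comm' (s := A) (t := fun x => x.divisors.filter (P x))
      (t' := (Icc 2 M).filter (· ∈ Nat.smoothNumbers p))
      (s' := fun y => A.filter (fun x => y ∣ x ∧ x / y ∈ Nat.smoothNumbers (y.minFac + 1)))
      (f := fun x y => (1 / (x : ℝ)) * e y) ?_).trans ?_
    · intro x y
      simp only [hA, mem_Icc, mem_filter, Nat.mem_divisors, hP]
      constructor
      · rintro ⟨⟨⟨hx1, hxM⟩, hxs⟩, ⟨hyx, hx0⟩, hy2, hys⟩
        exact ⟨⟨⟨⟨hx1, hxM⟩, hxs⟩, hyx, hys⟩, ⟨hy2, (Nat.le_of_dvd (by omega) hyx).trans hxM⟩,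
          Nat.mem_smoothNumbers_of_dvd hxs hyx⟩
      · rintro ⟨⟨⟨⟨hx1, hxM⟩, hxs⟩, hyx, hys⟩, ⟨hy2, hyM⟩, _⟩
        exact ⟨⟨⟨hx1, hxM⟩, hxs⟩, ⟨hyx, by omega⟩, hy2, hys⟩
    · exact Finset.sum_congr rfl fun y _ => Finset.sum_congr rfl fun x _ => mul_comm _ _
  -- the atom's users of an edge are among all its users
  have h3 : ∑ y ∈ (Icc 2 M).filter (· ∈ Nat.smoothNumbers p), e y *
        ∑ x ∈ A.filter (fun x => y ∣ x ∧ x / y ∈ Nat.smoothNumbers (y.minFac + 1)), (1 / (x : ℝ)) ≤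
      ∑ y ∈ (Icc 2 M).filter (· ∈ Nat.smoothNumbers p), e y * ((1 / (y : ℝ)) * eul y) := by
    refine Finset.sum_le_sum fun y hy => mul_le_mul_of_nonneg_left ?_ (he0 y)
    have hy1 : 1 ≤ y := by have := (mem_Icc.1 (mem_filter.1 hy).1).1; omega
    refine le_trans (Finset.sum_le_sum_of_subset_of_nonneg ?_ fun x _ _ => by positivity)
      (sum_inv_path_users_le (M := M) hy1)
    intro x hx
    simp only [hA, mem_filter] at hx ⊢
    exact ⟨hx.1.1, hx.2⟩
  calc ∑ x ∈ A, (1 / (x : ℝ)) * (g x - g 1) ^ 2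
      ≤ ∑ x ∈ A, (Nat.log 2 M : ℝ) * ((1 / (x : ℝ)) * ∑ y ∈ x.divisors with P x y, e y) := h1
    _ = (Nat.log 2 M : ℝ) * ∑ y ∈ (Icc 2 M).filter (· ∈ Nat.smoothNumbers p), e y *
          ∑ x ∈ A.filter (fun x => y ∣ x ∧ x / y ∈ Nat.smoothNumbers (y.minFac + 1)), (1 / (x : ℝ)) := by
        rw [← Finset.mul_sum, hcomm]
    _ ≤ (Nat.log 2 M : ℝ) * ∑ y ∈ (Icc 2 M).filter (· ∈ Nat.smoothNumbers p), e y * ((1 / (y : ℝ)) * eul y) :=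
        mul_le_mul_of_nonneg_left h3 (Nat.cast_nonneg _)
    _ = (Nat.log 2 M : ℝ) * ∑ y ∈ (Icc 2 M).filter (· ∈ Nat.smoothNumbers p),
          eul y * ((1 / (y : ℝ)) * (g y - g (y / y.minFac)) ^ 2) := by
        congr 1
        refine Finset.sum_congr rfl fun y _ => ?_
        simp only [he]
        ring

/-- **PROP. 24.7 on the `p`-free atom (Dirichlet-form version, Mertens constant as a hypothesis).**  If
`Π_{q ≤ r}(1 − 1/q)⁻¹ ≤ C·log r` for every prime `r ≤ M`, then for every `p` and `g`, with
`D_𝒜(g) = Σ_{x ≤ M, x p-free}(1/x)Σ_{n ∣ x}Λ(n)(g x − g(x/n))²` the atom's internal Dirichlet form,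
`Σ_{x ≤ M, x p-free}(1/x)(g x − g 1)² ≤ ⌊log₂M⌋·C·D_𝒜(g)`: the atom has the same `1/L` Poincaré constant. -/
theorem walk_poincare_mertens_dirichlet_atom (M p : ℕ) (g : ℕ → ℝ) {C : ℝ}
    (hC : ∀ r : ℕ, r.Prime → r ≤ M → ∏ q ∈ (r + 1).primesBelow, (1 - 1 / (q : ℝ))⁻¹ ≤ C * Real.log r) :
    ∑ x ∈ (Icc 1 M).filter (· ∈ Nat.smoothNumbers p), (1 / (x : ℝ)) * (g x - g 1) ^ 2 ≤
      (Nat.log 2 M : ℝ) * C * ∑ x ∈ (Icc 1 M).filter (· ∈ Nat.smoothNumbers p),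
        (1 / (x : ℝ)) * ∑ n ∈ x.divisors, vonMangoldt n * (g x - g (x / n)) ^ 2 := by
  rcases lt_or_ge M 2 with hM | hM
  · have hL : ∑ x ∈ (Icc 1 M).filter (· ∈ Nat.smoothNumbers p), (1 / (x : ℝ)) * (g x - g 1) ^ 2 = 0 :=
      Finset.sum_eq_zero fun x hx => by
        obtain rfl : x = 1 := by have := mem_Icc.1 (mem_filter.1 hx).1; omega
        simp
    rw [hL, Nat.log_of_lt hM]; simp
  have hCnn : 0 ≤ C := by
    have h1 : (1 : ℝ) ≤ ∏ q ∈ Nat.primesBelow (2 + 1), (1 - 1 / (q : ℝ))⁻¹ := one_le_prod_primesBelow_inv _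
    nlinarith [hC 2 Nat.prime_two hM, Real.log_pos (show (1 : ℝ) < 2 by norm_num)]
  have htree : ∑ y ∈ (Icc 2 M).filter (· ∈ Nat.smoothNumbers p),
        (∏ q ∈ (y.minFac + 1).primesBelow, (1 - 1 / (q : ℝ))⁻¹) * ((1 / (y : ℝ)) * (g y - g (y / y.minFac)) ^ 2) ≤
      C * ∑ x ∈ (Icc 1 M).filter (· ∈ Nat.smoothNumbers p),
        (1 / (x : ℝ)) * ∑ n ∈ x.divisors, vonMangoldt n * (g x - g (x / n)) ^ 2 := by
    rw [Finset.mul_sum]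
    have hsub : (Icc 2 M).filter (· ∈ Nat.smoothNumbers p) ⊆ (Icc 1 M).filter (· ∈ Nat.smoothNumbers p) := by
      intro x hx
      simp only [mem_filter, mem_Icc] at hx ⊢
      exact ⟨⟨by omega, hx.1.2⟩, hx.2⟩
    refine le_trans (Finset.sum_le_sum fun y hy => ?_)
      (Finset.sum_le_sum_of_subset_of_nonneg hsub fun x _ _ =>
        mul_nonneg hCnn (mul_nonneg (by positivity)
          (Finset.sum_nonneg fun n _ => mul_nonneg ArithmeticFunction.vonMangoldt_nonneg (sq_nonneg _))))
    have hy2 : 2 ≤ y := (mem_Icc.1 (mem_filter.1 hy).1).1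
    have hyM : y ≤ M := (mem_Icc.1 (mem_filter.1 hy).1).2
    have hpr : y.minFac.Prime := Nat.minFac_prime (by omega)
    have hπ : ∏ q ∈ (y.minFac + 1).primesBelow, (1 - 1 / (q : ℝ))⁻¹ ≤ C * Real.log y.minFac :=
      hC _ hpr ((Nat.minFac_le (by omega)).trans hyM)
    calc (∏ q ∈ (y.minFac + 1).primesBelow, (1 - 1 / (q : ℝ))⁻¹) * ((1 / (y : ℝ)) * (g y - g (y / y.minFac)) ^ 2)
        ≤ (C * Real.log y.minFac) * ((1 / (y : ℝ)) * (g y - g (y / y.minFac)) ^ 2) :=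
          mul_le_mul_of_nonneg_right hπ (by positivity)
      _ = C * ((1 / (y : ℝ)) * (Real.log y.minFac * (g y - g (y / y.minFac)) ^ 2)) := by ring
      _ ≤ C * ((1 / (y : ℝ)) * ∑ n ∈ y.divisors, vonMangoldt n * (g y - g (y / n)) ^ 2) :=
          mul_le_mul_of_nonneg_left (minFac_term_le_dirichlet_term'' g hy2) hCnn
  calc ∑ x ∈ (Icc 1 M).filter (· ∈ Nat.smoothNumbers p), (1 / (x : ℝ)) * (g x - g 1) ^ 2
      ≤ (Nat.log 2 M : ℝ) * ∑ y ∈ (Icc 2 M).filter (· ∈ Nat.smoothNumbers p),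
          (∏ q ∈ (y.minFac + 1).primesBelow, (1 - 1 / (q : ℝ))⁻¹) *
            ((1 / (y : ℝ)) * (g y - g (y / y.minFac)) ^ 2) := walk_poincare_mertens_atom M p g
    _ ≤ (Nat.log 2 M : ℝ) * (C * ∑ x ∈ (Icc 1 M).filter (· ∈ Nat.smoothNumbers p), (1 / (x : ℝ)) *
          ∑ n ∈ x.divisors, vonMangoldt n * (g x - g (x / n)) ^ 2) :=
        mul_le_mul_of_nonneg_left htree (Nat.cast_nonneg _)
    _ = _ := by ring

/-- **PROP. 24.7 on the `p`-free atom, unconditional with the explicit constant `e⁵`.** -/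
theorem walk_poincare_mertens_dirichlet_atom_exp_five (M p : ℕ) (g : ℕ → ℝ) :
    ∑ x ∈ (Icc 1 M).filter (· ∈ Nat.smoothNumbers p), (1 / (x : ℝ)) * (g x - g 1) ^ 2 ≤
      (Nat.log 2 M : ℝ) * Real.exp 5 * ∑ x ∈ (Icc 1 M).filter (· ∈ Nat.smoothNumbers p),
        (1 / (x : ℝ)) * ∑ n ∈ x.divisors, vonMangoldt n * (g x - g (x / n)) ^ 2 :=
  walk_poincare_mertens_dirichlet_atom M p g fun _ hr _ => prod_primesBelow_inv_le_exp_five_mul_log hr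

end Summit.RiemannHypothesis.RiemannHypothesis.Theorems.IntegerScrew

end
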